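import Summits.HodgeConjecture.HodgeConjecture.Theorems.CyclicUnitaryPowersDeckUnitaryGroup
import Literature.AlgebraicGeometry.Motives.HodgeStructureDeligneTorusMumfordTate

/-!
# Weight-two Hodge structures with `F³ = 0`: the three-term decomposition, real lines of type `(k,k)`, and the
# `s`-fixed line is of type `(1,1)`

Helper for stub T `stub_unitaryTorusLemma` of the crux `PowersHodgeOfDeckCommutators` (stmt-HodgeConjecture-19545,
route `CyclicUnitaryPowers`, line `unitary-kunneth-fft` v6, lane 2).  For a weight-`2` Hodge structure `H` on `V`
(`Motives/HodgeStructure`, pieces `V^{a,b}`, Hodge components `pieceProj` of `Motives/HodgeStructureWeilOperator`):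

* §1 `π_a π_b = [a = b] π_a`; under `F³ = 0` only the pieces `(2,0), (1,1), (0,2)` occur and `π₀ + π₁ + π₂ = 1`;
* §2 a conjugation-invariant nonzero vector all of whose Hodge components are proportional to it is of type `(k,k)`
  (`mem_piece_of_line`); if `dim_ℚ ker (s - 1) = 1` and `s ^ p = 1` the `s_ℂ`-fixed vectors form the complex line
  through a rational `s`-fixed vector (`exists_generator_of_finrank_eigenspace_eq_one`), whence **the `s_ℂ`-fixed line
  of an endomorphism `s` of the Hodge structure is of type `(1,1)`** (`mem_piece_one_one_of_fixed`).

The companion `CyclicUnitaryPowersHodgeTorusDeck` puts the Deligne torus element `h_ℂ(u, u⁻¹)` in `U⁰(ℂ)`.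
-/

noncomputable section

open Module
open scoped TensorProduct BigOperators

namespace Summit.HodgeConjecture.HodgeConjecture.Theorems.CyclicUnitaryPowersHodgeFixedLine

open Literature.AlgebraicGeometry.Motives
open Literature.AlgebraicGeometry.Motives.HodgeStructure
open Summit.HodgeConjecture.HodgeConjecture.Theorems.CyclicUnitaryPowersSpectralProjectors

universe u

variable {V : Type u} [AddCommGroup V] [Module ℚ V] {n : ℤ}

/-! ### §1 Hodge components; the three-term decomposition when `F³ = 0` -/

/-- `π_a π_b = [a = b] π_a`. [folklore] -/
theorem pieceProj_pieceProj (H : HodgeStructure V n) (a b : ℤ) (x : ℂ ⊗[ℚ] V) :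
    H.pieceProj a (H.pieceProj b x) = if a = b then H.pieceProj a x else 0 := by
  split_ifs with h
  · subst h
    exact pieceProj_apply_of_mem H (pieceProj_mem H a x)
  · exact pieceProj_apply_of_mem_ne H (Ne.symm h) (pieceProj_mem H b x)

/-- `π_a * π_b = [a = b] π_a` as endomorphisms. [folklore] -/
theorem pieceProj_mul_pieceProj (H : HodgeStructure V n) (a b : ℤ) :
    H.pieceProj a * H.pieceProj b = if a = b then H.pieceProj a else 0 := by
  refine LinearMap.ext fun x => ?_
  rw [Module.End.mul_apply, pieceProj_pieceProj]
  split_ifs <;> rfl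

/-- In weight `2` with `F³ = 0` the pieces `V^{a, 2-a}`, `a ≥ 3`, vanish. [folklore] -/
theorem piece_eq_bot_of_three_le (H : HodgeStructure V n) (hn : n = 2) (hF3 : H.F 3 = ⊥) {a : ℤ} (ha : 3 ≤ a) :
    H.piece a (n - a) = ⊥ := by
  subst hn
  refine eq_bot_iff.mpr fun x hx => ?_
  have h := piece_le_F H a (2 - a) hx
  have h' : H.F a ≤ H.F 3 := H.antitone_F ha
  rw [hF3] at h'
  exact h' h

/-- In weight `2` with `F³ = 0` the pieces `V^{a, 2-a}`, `a ≤ -1`, vanish (conjugates of the previous ones). [folklore] -/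
theorem piece_eq_bot_of_le_neg_one (H : HodgeStructure V n) (hn : n = 2) (hF3 : H.F 3 = ⊥) {a : ℤ} (ha : a ≤ -1) :
    H.piece a (n - a) = ⊥ := by
  subst hn
  refine eq_bot_iff.mpr fun x hx => ?_
  have h := piece_le_complexConj_F H a (2 - a) hx
  have h' : H.F (2 - a) ≤ H.F 3 := H.antitone_F (by omega)
  rw [hF3] at h'
  have h'' : complexConj (H.F (2 - a)) ≤ complexConj ⊥ := complexConj_mono h'
  rw [complexConj_bot] at h''
  exact h'' h

/-- Under `F³ = 0` (weight `2`) the Hodge components off `{0, 1, 2}` vanish. [folklore] -/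
theorem pieceProj_eq_zero_of_ne (H : HodgeStructure V n) (hn : n = 2) (hF3 : H.F 3 = ⊥) {a : ℤ}
    (h0 : a ≠ 0) (h1 : a ≠ 1) (h2 : a ≠ 2) (x : ℂ ⊗[ℚ] V) : H.pieceProj a x = 0 := by
  have hmem := pieceProj_mem H a x
  rcases le_or_gt 3 a with ha | ha
  · rw [piece_eq_bot_of_three_le H hn hF3 ha, Submodule.mem_bot] at hmem
    exact hmem
  · rw [piece_eq_bot_of_le_neg_one H hn hF3 (by omega), Submodule.mem_bot] at hmem
    exact hmem

/-- **`x = x^{0,2} + x^{1,1} + x^{2,0}`** in weight `2` with `F³ = 0`. [folklore] -/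
theorem sum_pieceProj_three (H : HodgeStructure V n) (hn : n = 2) (hF3 : H.F 3 = ⊥) (x : ℂ ⊗[ℚ] V) :
    H.pieceProj 0 x + H.pieceProj 1 x + H.pieceProj 2 x = x := by
  have hsupp : ∀ q, H.pieceProj q (H.pieceProj 0 x + H.pieceProj 1 x + H.pieceProj 2 x - x) = 0 := by
    intro q
    rw [map_sub, map_add, map_add, pieceProj_pieceProj, pieceProj_pieceProj, pieceProj_pieceProj]
    rcases eq_or_ne q 0 with rfl | h0
    · rw [if_pos rfl, if_neg (by norm_num), if_neg (by norm_num), add_zero, add_zero, sub_self]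
    rcases eq_or_ne q 1 with rfl | h1
    · rw [if_neg (by norm_num), if_pos rfl, if_neg (by norm_num), zero_add, add_zero, sub_self]
    rcases eq_or_ne q 2 with rfl | h2
    · rw [if_neg (by norm_num), if_neg (by norm_num), if_pos rfl, zero_add, zero_add, sub_self]
    rw [if_neg h0, if_neg h1, if_neg h2, add_zero, add_zero, zero_sub, neg_eq_zero,
      pieceProj_eq_zero_of_ne H hn hF3 h0 h1 h2 x]
  have h := eq_zero_of_forall_pieceProj_eq_zero H hsupp
  rwa [sub_eq_zero] at h

/-- `π₀ + π₁ + π₂ = 1` as endomorphisms (weight `2`, `F³ = 0`). [folklore] -/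
theorem pieceProj_zero_add_one_add_two (H : HodgeStructure V n) (hn : n = 2) (hF3 : H.F 3 = ⊥) :
    H.pieceProj 0 + H.pieceProj 1 + H.pieceProj 2 = 1 := by
  refine LinearMap.ext fun x => ?_
  rw [LinearMap.add_apply, LinearMap.add_apply, Module.End.one_apply]
  exact sum_pieceProj_three H hn hF3 x

/-! ### §2 Lines of type `(k,k)`; the `s`-fixed line -/

/-- **A real line stable under the Hodge projections is of type `(k,k)`**: if `x ≠ 0`, `conj x = x` and every
Hodge component `x^{p,n-p}` is a multiple of `x`, then `x ∈ V^{k,k}` (`n = 2k`): a component `x^{p,n-p} = c x` with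
`c ≠ 0`, `p ≠ k`, would put `x` in `V^{p,n-p} ∩ conj V^{p,n-p} = V^{p,n-p} ∩ V^{n-p,p} = 0`. [folklore] -/
theorem mem_piece_of_line (H : HodgeStructure V n) {k : ℤ} (hk : k + k = n) {x : ℂ ⊗[ℚ] V} (hx0 : x ≠ 0)
    (hconj : conj x = x) (hline : ∀ p, ∃ c : ℂ, H.pieceProj p x = c • x) : x ∈ H.piece k k := by
  have hk' : n - k = k := by omega
  rw [show H.piece k k = H.piece k (n - k) by rw [hk']]
  refine mem_piece_of_forall_ne_pieceProj_eq_zero H fun p hp => ?_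
  obtain ⟨c, hc⟩ := hline p
  by_contra hne
  have hc0 : c ≠ 0 := by
    rintro rfl
    rw [zero_smul] at hc
    exact hne hc
  have hxp : x ∈ H.piece p (n - p) := by
    have h := pieceProj_mem H p x
    rw [hc] at h
    have h2 := Submodule.smul_mem _ c⁻¹ h
    rwa [smul_smul, inv_mul_cancel₀ hc0, one_smul] at h2
  have hxq : x ∈ H.piece (n - p) (n - (n - p)) := by
    have h := conj_mem_piece H hxp
    rw [hconj] at h
    rwa [show n - (n - p) = p by omega]
  have e1 := pieceProj_apply_of_mem H hxp
  have e2 := pieceProj_apply_of_mem_ne H (show n - p ≠ p by omega) hxq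
  rw [e2] at e1
  exact hx0 e1.symm

section FixedLine

variable (s : V →ₗ[ℚ] V) {p : ℕ}

/-- The averaging operator `Σ_{i<p} sⁱ` is `s`-invariant when `s ^ p = 1`. [folklore] -/
theorem apply_sum_pow_apply (hsp : s ^ p = 1) (w : V) :
    s ((∑ i ∈ Finset.range p, s ^ i) w) = (∑ i ∈ Finset.range p, s ^ i) w := by
  rw [LinearMap.sum_apply, map_sum]
  have h : ∀ i, s ((s ^ i) w) = (s ^ (i + 1)) w := fun i => by rw [pow_succ', Module.End.mul_apply]
  simp_rw [h]
  exact sum_range_succ_shift (fun i => (s ^ i) w) (by rw [hsp, pow_zero])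

/-- `(Σ_{i<p} sⁱ)_ℂ x = p • x` for an `s_ℂ`-fixed vector `x`. [folklore] -/
theorem baseChange_sum_pow_apply_of_fixed {x : ℂ ⊗[ℚ] V} (hx : s.baseChange ℂ x = x) :
    (∑ i ∈ Finset.range p, s ^ i).baseChange ℂ x = (p : ℂ) • x := by
  have hpow : ∀ i : ℕ, (s.baseChange ℂ ^ i) x = x := by
    intro i
    induction i with
    | zero => rw [pow_zero, Module.End.one_apply]
    | succ i ih => rw [pow_succ, Module.End.mul_apply, hx, ih]
  have hsum : (∑ i ∈ Finset.range p, s ^ i).baseChange ℂ = ∑ i ∈ Finset.range p, (s ^ i).baseChange ℂ :=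
    map_sum (LinearMap.baseChangeHom ℚ ℂ V V) _ _
  rw [hsum, LinearMap.sum_apply]
  simp_rw [LinearMap.baseChange_pow, hpow]
  rw [Finset.sum_const, Finset.card_range, ← Nat.cast_smul_eq_nsmul ℂ]

/-- **If `dim_ℚ ker (s - 1) = 1` and `s ^ p = 1` (`p > 0`), the `s_ℂ`-fixed vectors of `V_ℂ` form the complex line
spanned by a rational `s`-fixed vector.** [folklore] -/
theorem exists_generator_of_finrank_eigenspace_eq_one (hp : 0 < p) (hsp : s ^ p = 1)
    (h1 : Module.finrank ℚ ↥(Module.End.eigenspace s 1) = 1) :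
    ∃ v : V, v ≠ 0 ∧ s v = v ∧
      ∀ x : ℂ ⊗[ℚ] V, s.baseChange ℂ x = x → ∃ c : ℂ, x = c • ((1 : ℂ) ⊗ₜ[ℚ] v) := by
  obtain ⟨⟨v, hv⟩, hv0, hgen⟩ := finrank_eq_one_iff'.mp h1
  have hv0' : v ≠ 0 := fun h => hv0 (Subtype.ext h)
  have hsv : s v = v := by
    have h := Module.End.mem_eigenspace_iff.mp hv
    rwa [one_smul] at h
  refine ⟨v, hv0', hsv, fun x hx => ?_⟩
  -- every rational vector averages into `ℚ v`
  have havg : ∀ w : V, ∃ q : ℚ, (∑ i ∈ Finset.range p, s ^ i) w = q • v := by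
    intro w
    have hmem : (∑ i ∈ Finset.range p, s ^ i) w ∈ Module.End.eigenspace s 1 := by
      rw [Module.End.mem_eigenspace_iff, one_smul]
      exact apply_sum_pow_apply s hsp w
    obtain ⟨q, hq⟩ := hgen ⟨_, hmem⟩
    exact ⟨q, by simpa using congrArg Subtype.val hq.symm⟩
  -- hence `(Σ sⁱ)_ℂ y ∈ ℂ (1 ⊗ v)` for every `y`
  have hrange : ∀ y : ℂ ⊗[ℚ] V, ∃ c : ℂ, (∑ i ∈ Finset.range p, s ^ i).baseChange ℂ y = c • ((1 : ℂ) ⊗ₜ[ℚ] v) := by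
    intro y
    induction y using TensorProduct.induction_on with
    | zero => exact ⟨0, by rw [map_zero, zero_smul]⟩
    | tmul a w =>
      obtain ⟨q, hq⟩ := havg w
      refine ⟨algebraMap ℚ ℂ q * a, ?_⟩
      have e : a • ((1 : ℂ) ⊗ₜ[ℚ] v) = a ⊗ₜ[ℚ] v := by
        rw [TensorProduct.smul_tmul', smul_eq_mul, mul_one]
      rw [LinearMap.baseChange_tmul, hq, TensorProduct.tmul_smul, mul_smul, e, algebraMap_smul]
    | add y₁ y₂ h₁ h₂ =>
      obtain ⟨c₁, hc₁⟩ := h₁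
      obtain ⟨c₂, hc₂⟩ := h₂
      exact ⟨c₁ + c₂, by rw [map_add, hc₁, hc₂, add_smul]⟩
  obtain ⟨c, hc⟩ := hrange x
  rw [baseChange_sum_pow_apply_of_fixed s hx] at hc
  have hp0 : (p : ℂ) ≠ 0 := Nat.cast_ne_zero.mpr hp.ne'
  refine ⟨(p : ℂ)⁻¹ * c, ?_⟩
  rw [mul_smul, ← hc, smul_smul, inv_mul_cancel₀ hp0, one_smul]

/-- **The `s_ℂ`-fixed line is of type `(1,1)`**: for an endomorphism `s` of a weight-`2` Hodge structure with
`dim_ℚ ker (s - 1) = 1` and `s ^ p = 1`, every `s_ℂ`-fixed vector lies in `V^{1,1}`. [folklore] -/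
theorem mem_piece_one_one_of_fixed (H : HodgeStructure V n) (hn : n = 2) (f : Hom H H) (hp : 0 < p)
    (hsp : f.toLinearMap ^ p = 1) (h1 : Module.finrank ℚ ↥(Module.End.eigenspace f.toLinearMap 1) = 1)
    {x : ℂ ⊗[ℚ] V} (hx : f.toLinearMap.baseChange ℂ x = x) : x ∈ H.piece 1 1 := by
  obtain ⟨v, hv0, hsv, hgen⟩ := exists_generator_of_finrank_eigenspace_eq_one f.toLinearMap hp hsp h1
  set x₀ : ℂ ⊗[ℚ] V := (1 : ℂ) ⊗ₜ[ℚ] v with hx₀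
  have hx₀0 : x₀ ≠ 0 := fun h => hv0 (one_tmul_injective (M := V) (by
    show (1 : ℂ) ⊗ₜ[ℚ] v = (1 : ℂ) ⊗ₜ[ℚ] (0 : V)
    rw [TensorProduct.tmul_zero]
    exact h))
  have hx₀fix : f.toLinearMap.baseChange ℂ x₀ = x₀ := by
    rw [hx₀, LinearMap.baseChange_tmul, hsv]
  have hx₀conj : conj x₀ = x₀ := by rw [hx₀, conj_tmul, map_one]
  have hline : ∀ q, ∃ c : ℂ, H.pieceProj q x₀ = c • x₀ := by
    intro q
    refine hgen _ ?_
    rw [f.baseChange_pieceProj q x₀, hx₀fix]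
  have hx₀mem : x₀ ∈ H.piece 1 1 := mem_piece_of_line H (by omega) hx₀0 hx₀conj hline
  obtain ⟨c, rfl⟩ := hgen x hx
  exact Submodule.smul_mem _ c hx₀mem

end FixedLine

end Summit.HodgeConjecture.HodgeConjecture.Theorems.CyclicUnitaryPowersHodgeFixedLine

end
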